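import Literature.NumberTheory.EllipticCurves.PAdicLFunctionInterpolationHoldsProofs
import Literature.NumberTheory.EllipticCurves.ModularSymbolsNormalizedSymbolProofs
import HarnessLib

/-!
# The distribution relation of `μ_{f,α}` holds unconditionally
# (provefact `Literature.NumberTheory.EllipticCurves.msdMeasure_distribution`; also `ratCast_ratPlusSymbol`,
# `exists_norm_msdMeasure_le`, `tendsto_padicLRiemannSum`)

D-0014 keeps `Literature/` sorry-free by stating cited results as named facts `def X : Prop`.
This sibling file of `Literature.NumberTheory.EllipticCurves.PAdicLFunction` discharges, sorry-free
and without any hypothesis, four of its named facts about the Mazur–Swinnerton-Dyer measure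
`μ_{f,α}(a + pⁿℤ_p) = α⁻ⁿ [a/pⁿ]⁺_f - α⁻ⁿ⁻¹ [a/pⁿ⁻¹]⁺_f` (`msdMeasure`) of a normalised newform
`f ∈ S₂(Γ₀(N))` with rational Fourier coefficients:

* `Literature.NumberTheory.EllipticCurves.ratCast_ratPlusSymbol_holds` : `([r]⁺_f : ℝ) = [r]_f`, i.e. the rational plus symbol
  `ratPlusSymbol f r ∈ ℚ` casts to `normalizedPlusSymbol f r = re (plusSymbol f r) / Ω⁺_f`
  (Mazur–Tate–Teitelbaum 1986, §I.8: the `[a/m]^±` are rational);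
* `Literature.NumberTheory.EllipticCurves.msdMeasure_distribution_holds` : **the distribution property**
  `∑_{b ≡ a (pⁿ)} μ_{f,α}(b + pⁿ⁺¹ℤ_p) = μ_{f,α}(a + pⁿℤ_p)` for `p ∤ N`, `a_p(f) = a_p ∈ ℤ`,
  `α ≠ 0`, `α² - a_p α + p = 0` (Mazur–Tate–Teitelbaum 1986, §I.10: the measure (10.1) and the
  Proposition of §I.10, (10.2), in the case of trivial Nebentypus; Mazur–Swinnerton-Dyer 1974, §8);
* `Literature.NumberTheory.EllipticCurves.exists_norm_msdMeasure_le_holds` : `μ_{f,α}` is bounded when `|α|_p = 1`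
  (Mazur–Tate–Teitelbaum 1986, §I.11; Delbourgo 2008, Thm. 2.2);
* `Literature.NumberTheory.EllipticCurves.tendsto_padicLRiemannSum_holds` : the Riemann sums defining the coefficients of
  `L_p(f, α, T)` converge (Mazur–Tate–Teitelbaum 1986, §I.11–I.13).

## The argument

Nothing new is proved about modular symbols here; the file only joins two reductions already in
the tree.

`PAdicLFunctionInterpolationHoldsProofs` reduced all four facts to **Manin–Drinfeld for `f`
alone** (`exists_nsmul_modularSymbol_mem_periodLattice f`: every `{∞, r}_f` has a positive
multiple in the period lattice `Λ_f`): `ratCast_ratPlusSymbol_of_maninDrinfeld`,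
`msdMeasure_distribution_of_maninDrinfeld` / `sum_fiber_msdMeasure_succ_eq` (the Hecke relation
`a_p [x]⁺ = ∑_{u mod p} [(x + u)/p]⁺ + [p x]⁺`, Mazur–Tate–Teitelbaum (4.2), together with
`α⁻¹ a_p - p α⁻² = 1`, which is exactly the printed proof of the Proposition of §I.10),
`exists_norm_msdMeasure_le_of_maninDrinfeld` (bounded denominators of the `[r]⁺_f`, §I.8, and
`|α⁻¹|_p = 1`) and `tendsto_padicLRiemannSum_of_maninDrinfeld`. Eichler–Shimura is not needed
because of the junk branch `Ω⁺_f = 0` built into `plusPeriod` (see that file and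
`ModularSymbolsNormalizedSymbolProofs`). Its hypothesis-free corollaries there concern the newform
of an elliptic curve (`IsNewformOf`), for which Manin–Drinfeld was available along that import
path.

`ModularSymbolsManinDrinfeldProofs` (imported through `ModularSymbolsNormalizedSymbolProofs`)
proves Manin–Drinfeld for every normalised newform with rational coefficients,
`exists_nsmul_modularSymbol_mem_periodLattice_of_isNewform0` (Manin 1972, Thm. 3.5 and Cor. 3.6:
closing the path with `T_ℓ`, `ℓ ∤ N` prime with `a_ℓ ≠ ℓ + 1`; Drinfeld 1973) — and "normalised
newform with rational coefficients" (`IsNewform0 f ∧ coeffField f = ⊥`) is precisely the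
hypothesis under which the four named facts are stated. Composing the two gives the facts with no
hypothesis left over. No statement of `PAdicLFunction` or `ModularSymbols` is changed.

## References

* B. Mazur, J. Tate, J. Teitelbaum, *On `p`-adic analogues of the conjectures of Birch and
  Swinnerton-Dyer*, Invent. Math. 84 (1986), 1–48, doi:10.1007/bf01388731: Ch. I, §4 (4.2) (the
  Hecke relation for modular symbols), §8 (the symbols `[a/m]^±`, rational with bounded
  denominators), §10 (10.1)–(10.2) and the Proposition of §10 (the measure `μ_{f,α}` and its
  distribution property), §11 (boundedness for the unit root), §13 (the `p`-adic `L`-function).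
* B. Mazur, P. Swinnerton-Dyer, *Arithmetic of Weil curves*, Invent. Math. 25 (1974), 1–61, §8.
* Ju. I. Manin, *Parabolic points and zeta functions of modular curves*, Izv. Akad. Nauk SSSR
  Ser. Mat. 36 (1972), 19–66, Thm. 3.5, Cor. 3.6; V. G. Drinfeld, *Two theorems on modular
  curves*, Funct. Anal. Appl. 7 (1973), 155–156.
* D. Delbourgo, *Elliptic curves and big Galois representations*, LMS Lecture Note Ser. 356,
  CUP 2008, §2.1 and Thm. 2.2 (PDF p. 41).
-/

noncomputable section

open scoped MatrixGroups ModularForm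

open CongruenceSubgroup Filter Topology Literature.NumberTheory.EllipticCurves.ModularForms

namespace Literature.NumberTheory.EllipticCurves

/-! ### Rationality of `[r]⁺_f` and the distribution relation (level-`N` facts) -/

section LevelFacts

variable {N : ℕ} {p : ℕ} [Fact p.Prime]

/-- **Discharge of `ratCast_ratPlusSymbol`** (`([r]⁺_f : ℝ) = [r]_f` for a normalised newform
`f ∈ S₂(Γ₀(N))` with rational coefficients; Mazur–Tate–Teitelbaum 1986, §I.8: the modular symbols
`[a/m]^±_f` are rational numbers): Manin–Drinfeld for rational newforms
(`exists_nsmul_modularSymbol_mem_periodLattice_of_isNewform0`; Manin 1972, Cor. 3.6) fed into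
`ratCast_ratPlusSymbol_of_maninDrinfeld` (the `dif` defining `ratPlusSymbol f r` takes its first
branch, in both branches of the definition of `Ω⁺_f`).
[cite: MazurTateTeitelbaum1986Invent, §I.8] -/
theorem ratCast_ratPlusSymbol_holds : ratCast_ratPlusSymbol (N := N) := by
  intro _ f hf hQ r
  exact ratCast_ratPlusSymbol_of_maninDrinfeld
    (exists_nsmul_modularSymbol_mem_periodLattice_of_isNewform0 hf hQ) r

/-- **Discharge of `msdMeasure_distribution` — the distribution property of the
Mazur–Swinnerton-Dyer measure `μ_{f,α}`** (Mazur–Tate–Teitelbaum 1986, §I.10: the measure (10.1)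
and the Proposition of §I.10, (10.2), for trivial Nebentypus; Mazur–Swinnerton-Dyer 1974, §8): for
a normalised newform `f ∈ S₂(Γ₀(N))` with rational coefficients, `p ∤ N`, `a_p(f) = a_p ∈ ℤ` and
`α ≠ 0` with `α² - a_p α + p = 0`,
`∑_{b ≡ a (pⁿ)} μ_{f,α}(b + pⁿ⁺¹ℤ_p) = μ_{f,α}(a + pⁿℤ_p)` for all `n` and `a mod pⁿ`. This is
`sum_fiber_msdMeasure_succ_eq` (`PAdicLFunctionDistributionProofs`: the Hecke relation
`a_p [x]⁺ = ∑_{u mod p} [(x + u)/p]⁺ + [p x]⁺`, Mazur–Tate–Teitelbaum (4.2), and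
`α⁻¹ a_p - p α⁻² = 1` — the printed proof) fed with the rationality `ratCast_ratPlusSymbol_holds`
(Manin–Drinfeld for rational newforms); equivalently `msdMeasure_distribution_of_maninDrinfeld`
with its Manin–Drinfeld hypothesis discharged for the forms the fact quantifies over.
[cite: MazurTateTeitelbaum1986Invent, §I.10 Prop. (10.2)] -/
theorem msdMeasure_distribution_holds : msdMeasure_distribution (N := N) (p := p) := by
  intro _ f hf hQ hpN _ hap _ hα₀ hα n a
  exact sum_fiber_msdMeasure_succ_eq (ratCast_ratPlusSymbol_holds hf hQ) hf hpN hap hα₀ hα n a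

end LevelFacts

/-! ### Boundedness and convergence of the Riemann sums (facts about a fixed `f`) -/

section FormFacts

variable {N : ℕ} [NeZero N] {f : CuspForm (Gamma0 N) 2} {p : ℕ} [Fact p.Prime]

/-- **Discharge of `exists_norm_msdMeasure_le`** (`μ_{f,α}` is bounded for a rational normalised
newform `f` of level prime to `p` and `|α|_p = 1`; Mazur–Tate–Teitelbaum 1986, §I.11; Delbourgo
2008, Thm. 2.2: "if `a_p(f)` is a `p`-adic unit then `μ_{f,α_p}` is a bounded measure"):
Manin–Drinfeld for rational newforms (`exists_nsmul_modularSymbol_mem_periodLattice_of_isNewform0`)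
fed into `exists_norm_msdMeasure_le_of_maninDrinfeld` (one common denominator `D` of the `[r]⁺_f`,
so `|μ(a + pⁿℤ_p)|_p ≤ 2 |1/D|_p`). The hypotheses `p ∤ N`, `a_p(f) = a_p`, `α² - a_p α + p = 0`
of the named fact are not used. [cite: Delbourgo2008, Thm. 2.2 (PDF p. 41)] -/
theorem exists_norm_msdMeasure_le_holds : exists_norm_msdMeasure_le (f := f) (p := p) := by
  intro hf hQ _ _ _ _ _ hαu
  exact exists_norm_msdMeasure_le_of_maninDrinfeld
    (exists_nsmul_modularSymbol_mem_periodLattice_of_isNewform0 hf hQ) hαu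

/-- **Discharge of `tendsto_padicLRiemannSum`** (`μ_{f,α}` is a measure for the unit root: for a
rational normalised newform `f` of level prime to `p`, `a_p(f) = a_p`, `α² - a_p α + p = 0`,
`|α|_p = 1`, the Riemann sums defining the `k`-th coefficient of `L_p(f, α, T)` converge;
Mazur–Tate–Teitelbaum 1986, §I.11–I.13; Mazur–Swinnerton-Dyer 1974, §8): Manin–Drinfeld for
rational newforms fed into `tendsto_padicLRiemannSum_of_maninDrinfeld` (the distribution relation
and the bound make the Riemann sums Cauchy, `tendsto_padicLRiemannSum_of_norm_le`).
[cite: MazurTateTeitelbaum1986Invent, §I.11–I.13] -/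
theorem tendsto_padicLRiemannSum_holds : tendsto_padicLRiemannSum (f := f) (p := p) := by
  intro hf hQ
  exact tendsto_padicLRiemannSum_of_maninDrinfeld
    (exists_nsmul_modularSymbol_mem_periodLattice_of_isNewform0 hf hQ) hf hQ

end FormFacts

end Literature.NumberTheory.EllipticCurves
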